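import Mathlib
import Literature.Geometry.Lorentzian.KerrConvergence
import Literature.Geometry.Lorentzian.KerrSchildEnergyEstimate
import Literature.Geometry.Lorentzian.BoostedKerrSchildDecay
import Literature.Geometry.Lorentzian.MultiCentreRadiationZone
import Literature.Geometry.Lorentzian.SpacetimeChartDeviationTransfer
import HarnessLib

/-!
# FarFlatTransfer

Topic `Literature/Uncategorized`. Named literature fact(s) relocated by the gate from `Summits/FinalStateConjecture/FinalStateConjecture/Theorems/StarvedNecksNeckGapDecayStubFarFlatTransfer.lean`
(accept-time relocation of `[cite]`d propositions written inline in a Summits proposal; human ruling 2026-08-15).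

* `Literature.Uncategorized.FarFlatTransfer`
-/

namespace Literature.Uncategorized

open scoped Manifold ContDiff Topology ENNReal
open Filter Set MeasureTheory Topology Literature.Geometry.Lorentzian

/-- **F — far flat transfer** (soft; stub F of the `NeckGapDecay` skeleton, line `Sketch`).  For a
`C⁴` final-state decomposition `d` with pairwise distinct hole velocities (DV) and orthochronous
label boosts `(Λⱼe₀)⁰ > 0`, a hole `i`, and a non-decreasing sublinear wall `W`: for every `ε > 0`
there are a radius `P` and a rest time `T` such that on every late rest slab `{tᵢ = τ}`, `τ ≥ T`, the
far collar `{max(ρᵢ(x⁰), P) + 1 ≤ rᵢ ≤ W(x⁰)}` (i) lies in the flat domain `U₀` (the other holes'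
excised tubes `{rⱼ ≤ ρⱼ(x⁰)}` recede linearly in `τ` by DV while `W, ρⱼ = o(t)`), and (ii) there the
`C²` sup of `(Φ^*g − η) + (η − g_{Kerrᵢ,Λᵢ,cᵢ})` is `≤ ε` (radiation-zone certificate on the lab
slabs met by the collar, plus the `C/r` decay of all derivatives of the boosted Kerr–Schild
perturbation beyond `r ≥ P + 1`).  Kerr–Schild 1965 §3; DHRT arXiv:2104.08222 §1. [folklore] -/
def FarFlatTransfer : Prop :=
  ∀ (𝓢 : Spacetime.{0} 4) (O : Set 𝓢.carrier) (d : FinalStateDecomposition 𝓢 O 4),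
    (∀ i j : Fin d.N, i ≠ j →
      ((d.motion i).1 : E4 ≃L[ℝ] E4) (E4.basisVector 0) ≠ ((d.motion j).1 : E4 ≃L[ℝ] E4) (E4.basisVector 0)) →
    (∀ j : Fin d.N, 0 < ((d.motion j).1 : E4 ≃L[ℝ] E4) (E4.basisVector 0) 0) →
    ∀ (i : Fin d.N) (W : ℝ → ℝ), Monotone W → Tendsto (fun s ↦ W s / s) atTop (𝓝 0) →
      ∀ ε : ℝ, 0 < ε → ∃ P T : ℝ, ∀ τ : ℝ, T ≤ τ →
        let B := d.background i
        let S : Set B.domain :=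
          {x | B.time x.1 = τ ∧ max (d.excision i (x.1 0)) P + 1 ≤ B.radius x.1 ∧ B.radius x.1 ≤ W (x.1 0)}
        (∀ x ∈ S, x.1 ∈ (d.flatDomain : Set E4)) ∧
        supCkENorm (Subtype.val '' S) 2
          (fun y ↦ 𝓢.deviationExtend (Minkowski.backgroundOn d.flatDomain) d.flatChart y +
            (Minkowski.bilin - boostedKerrBilin (d.motion i).1 (d.motion i).2 (d.mass i) (d.spin i) y)) ≤
          ENNReal.ofReal ε

/-! ## Real-variable tails -/

end Literature.Uncategorized
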